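import Literature.NumberTheory.Automorphic.UnitaryGroupSymplecticCarriers
import Literature.Analysis.SegalBargmann.SchwartzTorusIdentification
import Literature.Analysis.SegalBargmann.SchrodingerCovariantUniqueness
import Literature.Analysis.SegalBargmann.FockInvariantLines
import HarnessLib

/-!
# The compact diagonal torus of `U(T)(ℂ/ℝ)` in adapted Folland coordinates (the archimedean `κ`-sign)

Topic `NumberTheory/Weil1964`; namespace `Literature.NumberTheory.Weil1964`. Definitions and proved lemmas only
(finite-dimensional linear algebra over `ℝ`/`ℂ`): **no named facts, no records, 0 proof holes**.

**Setting.** `R = ℝ`, `S = ℂ` with quadratic coordinates `IsQuadraticCoordinates Complex.ofRealHom Ψ δ' d`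
(`UnitaryGroup.QuadraticRestrictionOfScalars`: `Ψ (a, b) = a + b δ'`, `δ'² = d`) for a **purely imaginary** `δ'`
(`δ'.re = 0`; then `m := δ'.im ≠ 0`, `d = -m²`, `re_Ψ z = re z`, `im_Ψ z = im z / m` — §1); this is the shape of the
tree's complex-place coordinates `complexCoords (σ_w δ)` of `UnitaryGroupSymplecticCarriers` §4, for EITHER sign of
`im σ_w(δ)`. A real diagonal Gram matrix `T = diagonal t` (`t : n → ℝ`, any signs, any finite index type `n`), the
restriction-of-scalars action `resAut : GLₙ(ℂ) →* (ℝⁿ × ℝⁿ ≃ₗ ℝⁿ × ℝⁿ)` of `UnitaryGroupSymplecticEmbedding` §3 (block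
formula `resAut_apply_mk`), and on the other side the tree's phase-space currency of `Analysis/SegalBargmann`:
`realify U (p, q) = (re U(p + iq), im U(p + iq))` (`SchrodingerCovariantUniqueness`), the diagonal torus
`diagHom : (S¹)ⁿ →* U(n)` (`FockInvariantLines`) and `torusPt θ = (e^{-iθ_j})_j` (`SchwartzTorusIdentification`).

* §1 `IsQuadraticCoordinates Complex.ofRealHom Ψ δ' d` with `δ'.re = 0`: `δ'.im ≠ 0`, `re_Ψ = re`, `im_Ψ = im / δ'.im`,
  `d = -(δ'.im)²`.
* §2 the compact diagonal torus `torusGL θ = diag(e^{iθ_j}) ∈ GLₙ(ℂ)` and its membership in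
  `unitaryGroupOfForm conj (diagonal c)` for every diagonal form matrix (in particular `(diagonal t).map ofReal`,
  the `H = T.map φ` of `toSymplectic`).
* §3 the **adapted Folland scaling** `follandScale D t (a, b) = (D a, -D⁻¹ T b)` (componentwise `(D_j a_j, -(t_j/D_j) b_j)`)
  and the main computation: if `δ'.im · D_j² = ε_j · t_j` with `ε_j = ±1` (so `D_j² = |t_j| / |δ'.im|`,
  `ε_j = sgn(δ'.im · t_j)`), then for every `θ` and every `(a, b)`
  **`follandScale D t (resAut (torusGL θ) (a, b)) = realify (diagHom (torusPt (ε · θ))) (follandScale D t (a, b))`**: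
  in the adapted coordinates the torus element `diag(e^{iθ_j})` of `U(T)` acts on the `j`-th coordinate plane
  `(p_j, q_j)` as the rotation `realify (e^{-iε_jθ_j})`, i.e. as the image of the torus point `torusPt (ε_j θ_j)`;
  the sign vector `ε_j = sgn(δ'.im · T_jj)` is forced (for `δ'.im > 0` it is `sgn T_jj`).
* §4 the same as a conjugation `follandScale ∘ resAut (torusGL θ) ∘ follandScale⁻¹ = realify (diagHom (torusPt (ε · θ)))`
  (`follandScaleEquiv`, for `t_j ≠ 0`), and the canonical adapted choice `D_j = √(|t_j| / |δ'.im|)`,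
  `ε_j = sgn(δ'.im · t_j)`.
* §5 the tree's complex-place carrier: at a complex place `w` of a CM-type quadratic extension `E/F` fixed by `c`,
  for a diagonal `F`-rational Gram matrix `J = diag(t₀) ⊗ 1`, `torusGL θ ∈ archLocal E N J w = U(σ_w J)(ℂ)`
  (`UnitaryGroupArchimedeanPlaces`) and the main computation read on
  `archLocalToSymplectic w : archLocal E N J w →* Sp(ℝᴺ × ℝᴺ)` of `UnitaryGroupSymplecticCarriers` §4 (coordinates
  `complexCoords (σ_w δ)`, `m = im σ_w(δ)`, `t_j = σ_w(t₀_j) ∈ ℝ`): sign vector `ε_j = sgn(im σ_w(δ) · σ_w(t₀_j))`.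

Dictionary with print: Folland identifies `ℝ²ⁿ = ℂⁿ` by `(p, q) ↔ p + iq`, under which `Sp ∩ O(2n) = U(n)`
(Prop. (4.6)); `realify` is that identification read on matrices. The unitary group of a hermitian space over `ℂ/ℝ`
sits in the symplectic group of the underlying real space with the form `im h` (Mœglin–Vignéras–Waldspurger Ch. 1
I.17), which is `toSymplectic` of `UnitaryGroupSymplecticEmbedding`; the scaling `(a, b) ↦ (p, q) = (D a, -D⁻¹ T b)`
takes the invariant form `⟪(a, b), (a', b')⟫_T = Σ_j t_j (a_j b'_j - a'_j b_j)` (`im h`, `im_hermForm_map`) to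
`-Σ_j (p_j q'_j - p'_j q_j)` for EVERY `D` (`follandScale_symplectic`: it is anti-symplectic for the standard form of the
`(p, q)`-plane), and the content of §3 is the bookkeeping of which rotation direction each coordinate plane inherits
once `D` is adapted (`|δ'.im| D_j² = |t_j|`).

## Mathlib / tree

Mathlib: `Matrix.diagonal`, `Matrix.mulVec_diagonal`, `Matrix.diagonal_map`, `Matrix.diagonal_transpose`,
`Matrix.diagonal_mul_diagonal`, `Unitary.toUnits`, `Circle.exp`, `Circle.coe_exp`, `Complex.exp_ofReal_mul_I_re/im`,
`SignType.sign`, `sign_mul_abs`, `Real.sq_sqrt`.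
Tree: `UnitaryGroup.IsQuadraticCoordinates` (`re_eq`, `im_eq`, `mul_self`, `resAut`, `resAut_apply_mk`),
`UnitaryGroup.unitaryGroupOfForm` (`mem_unitaryGroupOfForm_iff`), `UnitaryGroup.archLocal`,
`UnitaryGroup.archLocalToSymplectic` (`isQuadraticCoordinates_complex`, `realPlaceMap`, `archLocalForm_eq_map`,
`re_embedding_delta`, `im_embedding_delta_ne_zero`), `SegalBargmann.realify`, `SegalBargmann.diagHom` (`coe_diagHom`),
`SegalBargmann.torusPt`, `SegalBargmann.phasePt` (`phasePt_apply`).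

## Provenance

Written under the LEAN-IN-TREE rule (2026-08-18) for the pub-hodgecm formalisation cell (HAZARD γ-K (b) / D5-arch,
the archimedean `κ`-sign: STEP 1 "torus in Folland coordinates", spec of the binder-2 lane 2026-08-19); KERNEL only —
the adelic bridge to `archFolland` / `archAct` and the Fock-side consequences are separate files. Nothing here is a
claim of the sources beyond the cited dictionary; all statements are proved.
-/

open scoped Matrix
open Complex
open Literature.NumberTheory.Automorphic Literature.NumberTheory.Automorphic.UnitaryGroup
open Literature.Analysis.SegalBargmann

namespace Literature.NumberTheory.Weil1964

/-! ## 1. Purely imaginary quadratic coordinates on `ℂ/ℝ` -/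

section Coordinates

variable {Ψ : (ℝ × ℝ) ≃+ ℂ} {δ' : ℂ} {d : ℝ} (h : IsQuadraticCoordinates Complex.ofRealHom Ψ δ' d)
include h

/-- If `Ψ (a, b) = a + b δ'` is a bijection `ℝ × ℝ ≃ ℂ` with `δ'` purely imaginary, then `im δ' ≠ 0`. [folklore] -/
theorem im_ne_zero_of_isQuadraticCoordinates (hre : δ'.re = 0) : δ'.im ≠ 0 := by
  intro him
  have hδ : δ' = 0 := Complex.ext (by simpa using hre) (by simpa using him)
  have h01 : Ψ (0, 1) = Ψ (0, 0) := by rw [h.apply, h.apply, hδ]; simp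
  have := Ψ.injective h01
  simpa using congrArg Prod.snd this

/-- `z = re z + (im z / im δ') · δ'` for `δ'` purely imaginary. [folklore] -/
theorem ofReal_re_add_ofReal_im_div_mul (hre : δ'.re = 0) (z : ℂ) :
    Complex.ofRealHom z.re + Complex.ofRealHom (z.im / δ'.im) * δ' = z := by
  have him := im_ne_zero_of_isQuadraticCoordinates h hre
  apply Complex.ext
  · simp [hre]
  · simp [hre, him]

/-- In purely imaginary coordinates the first coordinate is the real part: `re_Ψ z = re z`. [folklore] -/
theorem re_eq_re (hre : δ'.re = 0) (z : ℂ) : QuadraticCoordinates.re Ψ z = z.re := by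
  have := h.re_eq z.re (z.im / δ'.im)
  rwa [ofReal_re_add_ofReal_im_div_mul h hre] at this

/-- In purely imaginary coordinates the second coordinate is `im z / im δ'`. [folklore] -/
theorem im_eq_im_div (hre : δ'.re = 0) (z : ℂ) : QuadraticCoordinates.im Ψ z = z.im / δ'.im := by
  have := h.im_eq z.re (z.im / δ'.im)
  rwa [ofReal_re_add_ofReal_im_div_mul h hre] at this

/-- `d = δ'² = -(im δ')²` for `δ'` purely imaginary. [folklore] -/
theorem d_eq_neg_sq (hre : δ'.re = 0) : d = -(δ'.im ^ 2) := by
  have hmul := congrArg Complex.re h.mul_self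
  simp only [Complex.mul_re, hre, zero_mul, zero_sub] at hmul
  have : (Complex.ofRealHom d).re = d := Complex.ofReal_re d
  rw [← this, ← hmul]
  ring

end Coordinates

/-! ## 2. The compact diagonal torus `diag(e^{iθ}) ∈ U(T)(ℂ) ⊂ GLₙ(ℂ)` -/

section Torus

variable {n : Type*} [Fintype n] [DecidableEq n]

/-- **The compact diagonal torus element** `torusGL θ = diag(e^{iθ_j})_j ∈ GLₙ(ℂ)` (the unitary matrix
`diagHom (e^{iθ_j})_j` as an invertible matrix). [folklore] -/
noncomputable def torusGL (θ : n → ℝ) : GL n ℂ := Unitary.toUnits (diagHom fun j => Circle.exp (θ j))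

/-- `torusGL θ = diagonal (e^{iθ_j})` as a matrix. [folklore] -/
@[simp] theorem coe_torusGL (θ : n → ℝ) :
    ((torusGL θ : GL n ℂ) : Matrix n n ℂ) = Matrix.diagonal fun j => cexp ((θ j : ℂ) * I) := by
  change ((diagHom fun j => Circle.exp (θ j) : Matrix.unitaryGroup n ℂ) : Matrix n n ℂ) = _
  exact (coe_diagHom _).trans (congrArg Matrix.diagonal (funext fun j => Circle.coe_exp (θ j)))

/-- `torusGL` is a homomorphism `ℝⁿ → GLₙ(ℂ)`: `torusGL (θ + θ') = torusGL θ * torusGL θ'`. [folklore] -/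
theorem torusGL_add (θ θ' : n → ℝ) : torusGL (θ + θ') = torusGL θ * torusGL θ' := by
  have hfun : (fun j => Circle.exp ((θ + θ') j)) = (fun j => Circle.exp (θ j)) * fun j => Circle.exp (θ' j) :=
    funext fun j => by rw [Pi.add_apply, Pi.mul_apply, Circle.exp_add]
  simp only [torusGL, hfun, map_mul]

/-- `torusGL 0 = 1`. [folklore] -/
@[simp] theorem torusGL_zero : torusGL (0 : n → ℝ) = 1 := by
  have hfun : (fun j => Circle.exp ((0 : n → ℝ) j)) = 1 :=
    funext fun j => by rw [Pi.zero_apply, Pi.one_apply, Circle.exp_zero]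
  simp only [torusGL, hfun, map_one]

/-- `torusGL (-θ) = (torusGL θ)⁻¹`. [folklore] -/
theorem torusGL_neg (θ : n → ℝ) : torusGL (-θ) = (torusGL θ)⁻¹ :=
  eq_inv_of_mul_eq_one_left (by rw [← torusGL_add, neg_add_cancel, torusGL_zero])

/-- `torusGL θ` is a unitary matrix: it lies in the compact group `Matrix.unitaryGroup n ℂ = U(n)`. [folklore] -/
theorem coe_torusGL_mem_unitaryGroup (θ : n → ℝ) :
    ((torusGL θ : GL n ℂ) : Matrix n n ℂ) ∈ Matrix.unitaryGroup n ℂ :=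
  (diagHom fun j => Circle.exp (θ j)).2

/-- **A diagonal unitary matrix preserves every diagonal hermitian form**: `diag(u) ∈ unitaryGroupOfForm conj (diag c)`
for `u ∈ (S¹)ⁿ` and any `c : n → ℂ` (`ū_j c_j u_j = c_j`). [folklore] -/
theorem toUnits_diagHom_mem_unitaryGroupOfForm_diagonal (u : n → Circle) (c : n → ℂ) :
    (Unitary.toUnits (diagHom u) : GL n ℂ) ∈ unitaryGroupOfForm (starRingEnd ℂ) (Matrix.diagonal c) := by
  rw [mem_unitaryGroupOfForm_iff]
  change ((Matrix.diagonal fun j => ((u j : Circle) : ℂ)).map (starRingEnd ℂ))ᵀ * Matrix.diagonal c *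
      Matrix.diagonal (fun j => ((u j : Circle) : ℂ)) = Matrix.diagonal c
  rw [Matrix.diagonal_map (map_zero _), Matrix.diagonal_transpose, Matrix.diagonal_mul_diagonal,
    Matrix.diagonal_mul_diagonal]
  congr 1
  funext j
  rw [mul_comm (starRingEnd ℂ _) (c j), mul_assoc, ← Complex.normSq_eq_conj_mul_self, Circle.normSq_coe,
    Complex.ofReal_one, mul_one]

/-- **`torusGL θ ∈ U(diag c)`** for every diagonal form matrix `c`. [folklore] -/
theorem torusGL_mem_unitaryGroupOfForm_diagonal (θ : n → ℝ) (c : n → ℂ) :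
    torusGL θ ∈ unitaryGroupOfForm (starRingEnd ℂ) (Matrix.diagonal c) :=
  toUnits_diagHom_mem_unitaryGroupOfForm_diagonal _ c

/-- **`torusGL θ ∈ U(T ⊗ 1)`** for a real diagonal Gram matrix `T = diagonal t` — the form `H = T.map φ` of
`IsQuadraticCoordinates.toSymplectic`. [cite: MoeglinVignerasWaldspurger1987, Ch. 1 I.17] -/
theorem torusGL_mem_unitaryGroupOfForm_map (θ : n → ℝ) (t : n → ℝ) :
    torusGL θ ∈ unitaryGroupOfForm (starRingEnd ℂ) ((Matrix.diagonal t).map Complex.ofRealHom) := by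
  rw [Matrix.diagonal_map (map_zero _)]
  exact torusGL_mem_unitaryGroupOfForm_diagonal θ _

end Torus

/-! ## 3. The torus in adapted Folland coordinates -/

section Scale

variable {n : Type*}

/-- **The adapted Folland scaling** `(a, b) ↦ (D a, -D⁻¹ T b)` for diagonal `D = diag(D_j)`, `T = diag(t_j)`:
componentwise `(D_j a_j, -(t_j / D_j) b_j)`. [folklore] -/
noncomputable def follandScale (D t : n → ℝ) : PhaseMap n := fun ab =>
  (fun j => D j * ab.1 j, fun j => -(t j / D j) * ab.2 j)

/-- `follandScale D t (a, b) = (D a, -(t/D) b)` componentwise (definitional). [folklore] -/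
@[simp] theorem follandScale_apply (D t : n → ℝ) (ab : (n → ℝ) × (n → ℝ)) :
    follandScale D t ab = (fun j => D j * ab.1 j, fun j => -(t j / D j) * ab.2 j) := rfl

end Scale

section Symplectic

variable {n : Type*} [Fintype n]

/-- **The Folland scaling is anti-symplectic** from `⟪(a, b), (a', b')⟫_T = Σ_j t_j (a_j b'_j - a'_j b_j)` to the
standard form `Σ_j (p_j q'_j - p'_j q_j)` of the `(p, q)`-coordinates, for every `D` with `D_j ≠ 0`. [folklore] -/
theorem follandScale_symplectic (D t : n → ℝ) (hD : ∀ j, D j ≠ 0) (ab ab' : (n → ℝ) × (n → ℝ)) :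
    ∑ j, ((follandScale D t ab).1 j * (follandScale D t ab').2 j -
        (follandScale D t ab').1 j * (follandScale D t ab).2 j) =
      -∑ j, t j * (ab.1 j * ab'.2 j - ab'.1 j * ab.2 j) := by
  rw [← Finset.sum_neg_distrib]
  refine Finset.sum_congr rfl fun j _ => ?_
  have hDj := hD j
  simp only [follandScale_apply]
  field_simp
  ring

end Symplectic

section Folland

variable {n : Type*} [Fintype n] [DecidableEq n]

/-- **`realify` of a diagonal torus point is a coordinatewise rotation**:
`realify (diagHom (torusPt φ)) (p, q)_j = (cos φ_j p_j + sin φ_j q_j, -sin φ_j p_j + cos φ_j q_j)`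
(`torusPt φ = e^{-iφ}`, `e^{-iφ}(p + iq)`). [cite: Folland1989, Ch. 4 §1, Prop. (4.6) p. 151] -/
theorem realify_diagHom_torusPt (φ : n → ℝ) (pq : (n → ℝ) × (n → ℝ)) :
    realify (diagHom (torusPt φ)) pq =
      (fun j => Real.cos (φ j) * pq.1 j + Real.sin (φ j) * pq.2 j,
        fun j => -Real.sin (φ j) * pq.1 j + Real.cos (φ j) * pq.2 j) := by
  have hcoe : ((diagHom (torusPt φ) : Matrix.unitaryGroup n ℂ) : Matrix n n ℂ) =
      Matrix.diagonal fun j => cexp (((-φ j : ℝ) : ℂ) * I) :=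
    (coe_diagHom _).trans (congrArg Matrix.diagonal (funext fun j => Circle.coe_exp (-φ j)))
  refine Prod.ext (funext fun j => ?_) (funext fun j => ?_)
  · simp only [realify, hcoe, Matrix.mulVec_diagonal, phasePt_apply, Complex.mul_re, Complex.add_re,
      Complex.add_im, Complex.mul_im, Complex.exp_ofReal_mul_I_re, Complex.exp_ofReal_mul_I_im,
      Complex.ofReal_re, Complex.ofReal_im, Complex.I_re, Complex.I_im, Real.cos_neg, Real.sin_neg]
    ring
  · simp only [realify, hcoe, Matrix.mulVec_diagonal, phasePt_apply, Complex.mul_re, Complex.add_re,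
      Complex.add_im, Complex.mul_im, Complex.exp_ofReal_mul_I_re, Complex.exp_ofReal_mul_I_im,
      Complex.ofReal_re, Complex.ofReal_im, Complex.I_re, Complex.I_im, Real.cos_neg, Real.sin_neg]
    ring

variable {Ψ : (ℝ × ℝ) ≃+ ℂ} {δ' : ℂ} {d : ℝ} (h : IsQuadraticCoordinates Complex.ofRealHom Ψ δ' d)
include h

/-- **The torus element in the real coordinates `(a, b)`** (`x = a + b δ'`): `diag(e^{iθ})` acts by
`a'_j = cos θ_j a_j - δ'.im sin θ_j b_j`, `b'_j = (sin θ_j / δ'.im) a_j + cos θ_j b_j`. [folklore] -/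
theorem resAut_torusGL_apply (hre : δ'.re = 0) (θ : n → ℝ) (a b : n → ℝ) :
    h.resAut n (torusGL θ) (a, b) =
      (fun j => Real.cos (θ j) * a j - δ'.im * Real.sin (θ j) * b j,
        fun j => Real.sin (θ j) / δ'.im * a j + Real.cos (θ j) * b j) := by
  have him := im_ne_zero_of_isQuadraticCoordinates h hre
  have hre' : ((torusGL θ : GL n ℂ) : Matrix n n ℂ).map (QuadraticCoordinates.re Ψ) =
      Matrix.diagonal fun j => Real.cos (θ j) := by
    rw [coe_torusGL, Matrix.diagonal_map (map_zero _)]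
    congr 1
    funext j
    rw [re_eq_re h hre, Complex.exp_ofReal_mul_I_re]
  have him' : ((torusGL θ : GL n ℂ) : Matrix n n ℂ).map (QuadraticCoordinates.im Ψ) =
      Matrix.diagonal fun j => Real.sin (θ j) / δ'.im := by
    rw [coe_torusGL, Matrix.diagonal_map (map_zero _)]
    congr 1
    funext j
    rw [im_eq_im_div h hre, Complex.exp_ofReal_mul_I_im]
  rw [h.resAut_apply_mk, hre', him', d_eq_neg_sq h hre]
  refine Prod.ext (funext fun j => ?_) (funext fun j => ?_)
  · simp only [Pi.add_apply, Pi.smul_apply, Matrix.mulVec_diagonal, smul_eq_mul]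
    field_simp
    ring
  · simp only [Pi.add_apply, Matrix.mulVec_diagonal]

/-- **The compact torus of `U(T)` in adapted Folland coordinates (archimedean `κ`-sign).** For a real diagonal Gram
matrix `T = diag(t_j)` and a scaling `D` ADAPTED to `T` and to the coordinates — `δ'.im · D_j² = ε_j · t_j` with signs
`ε_j = ±1` (i.e. `D_j² = |t_j| / |δ'.im|`, `ε_j = sgn(δ'.im · t_j)`) — the torus element `diag(e^{iθ_j})` acts, in the
coordinates `(p, q) = (D a, -D⁻¹ T b)`, as the phase-space map of the diagonal unitary `diag(e^{-iε_jθ_j})`: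
`follandScale (resAut (torusGL θ) (a, b)) = realify (diagHom (torusPt (ε · θ))) (follandScale (a, b))`, the rotation
by `-ε_j θ_j` of the `j`-th coordinate plane. [cite: Folland1989, Ch. 4 §1, Prop. (4.6) p. 151] -/
theorem follandScale_resAut_torusGL (hre : δ'.re = 0) {t D ε : n → ℝ} (ht : ∀ j, t j ≠ 0)
    (hD : ∀ j, δ'.im * D j ^ 2 = ε j * t j) (hε : ∀ j, ε j = 1 ∨ ε j = -1) (θ : n → ℝ) (ab : (n → ℝ) × (n → ℝ)) :
    follandScale D t (h.resAut n (torusGL θ) ab) =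
      realify (diagHom (torusPt fun j => ε j * θ j)) (follandScale D t ab) := by
  have him := im_ne_zero_of_isQuadraticCoordinates h hre
  obtain ⟨a, b⟩ := ab
  rw [resAut_torusGL_apply h hre, realify_diagHom_torusPt, follandScale_apply, follandScale_apply]
  refine Prod.ext (funext fun j => ?_) (funext fun j => ?_)
  all_goals
    have hDj : D j ≠ 0 := by
      intro h0
      have h2 := hD j
      rw [h0] at h2
      have h3 : ε j * t j = 0 := by rw [← h2]; ring
      rcases mul_eq_zero.mp h3 with h4 | h4
      · rcases hε j with h1 | h1 <;> simp [h1] at h4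
      · exact ht j h4
    have htj : t j = ε j * (δ'.im * D j ^ 2) := by
      rw [hD j]
      rcases hε j with h1 | h1 <;> · rw [h1]; ring
    simp only [htj]
    rcases hε j with h1 | h1
    · simp only [h1, one_mul]
      field_simp
      ring
    · simp only [h1, neg_mul, one_mul, Real.cos_neg, Real.sin_neg]
      field_simp
      try ring

end Folland

/-! ## 4. Conjugation form and the canonical adapted scaling -/

section Equiv

variable {n : Type*}

/-- The adapted Folland scaling as an `ℝ`-linear automorphism of `ℝⁿ × ℝⁿ` (for `D_j ≠ 0`, `t_j ≠ 0`), with inverse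
`(p, q) ↦ (D⁻¹ p, -D T⁻¹ q)`. [folklore] -/
noncomputable def follandScaleEquiv (D t : n → ℝ) (hD : ∀ j, D j ≠ 0) (ht : ∀ j, t j ≠ 0) :
    ((n → ℝ) × (n → ℝ)) ≃ₗ[ℝ] ((n → ℝ) × (n → ℝ)) where
  toFun := follandScale D t
  invFun pq := (fun j => (D j)⁻¹ * pq.1 j, fun j => -(D j / t j) * pq.2 j)
  map_add' x y := by
    refine Prod.ext (funext fun j => ?_) (funext fun j => ?_) <;> simp [mul_add]
  map_smul' c x := by
    refine Prod.ext (funext fun j => ?_) (funext fun j => ?_) <;> simp <;> ring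
  left_inv x := by
    refine Prod.ext (funext fun j => ?_) (funext fun j => ?_)
    · simp [hD j]
    · simp only [follandScale_apply]
      field_simp [hD j, ht j]
  right_inv x := by
    refine Prod.ext (funext fun j => ?_) (funext fun j => ?_)
    · simp [hD j]
    · simp only [follandScale_apply]
      field_simp [hD j, ht j]

/-- `follandScaleEquiv D t = follandScale D t` as a function. [folklore] -/
@[simp] theorem coe_follandScaleEquiv (D t : n → ℝ) (hD : ∀ j, D j ≠ 0) (ht : ∀ j, t j ≠ 0) :
    ⇑(follandScaleEquiv D t hD ht) = follandScale D t := rfl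

/-- **The canonical adapted scaling** `D_j = √(|t_j| / |m|)` with the sign vector `ε_j = sgn(m · t_j)` satisfies the
adaptedness identity `m · D_j² = ε_j · t_j` (`m ≠ 0`). [folklore] -/
theorem adapted_sqrt {m : ℝ} (hm : m ≠ 0) (t : n → ℝ) (j : n) :
    m * Real.sqrt (|t j| / |m|) ^ 2 = (SignType.sign (m * t j) : ℝ) * t j := by
  have habs : |m| ≠ 0 := abs_ne_zero.mpr hm
  rw [Real.sq_sqrt (div_nonneg (abs_nonneg _) (abs_nonneg _)), sign_mul, SignType.coe_mul, mul_assoc,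
    sign_mul_self]
  have hsm : (SignType.sign m : ℝ) * |m| = m := sign_mul_abs m
  calc m * (|t j| / |m|) = (SignType.sign m : ℝ) * |m| * (|t j| / |m|) := by rw [hsm]
    _ = (SignType.sign m : ℝ) * |t j| := by rw [mul_assoc, ← mul_div_assoc, mul_div_cancel_left₀ _ habs]

/-- The canonical sign vector takes values `±1` when `m · t_j ≠ 0`. [folklore] -/
theorem sign_eq_one_or {m : ℝ} (hm : m ≠ 0) {t : n → ℝ} (ht : ∀ j, t j ≠ 0) (j : n) :
    (SignType.sign (m * t j) : ℝ) = 1 ∨ (SignType.sign (m * t j) : ℝ) = -1 := by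
  rcases lt_or_gt_of_ne (mul_ne_zero hm (ht j)) with hlt | hgt
  · right
    rw [sign_neg hlt, SignType.coe_neg_one]
  · left
    rw [sign_pos hgt, SignType.coe_one]

end Equiv

section Canonical

variable {n : Type*} [Fintype n] [DecidableEq n]

variable {Ψ : (ℝ × ℝ) ≃+ ℂ} {δ' : ℂ} {d : ℝ} (h : IsQuadraticCoordinates Complex.ofRealHom Ψ δ' d)
include h

/-- **Conjugation form**: `follandScale ∘ resAut (torusGL θ) ∘ follandScale⁻¹ = realify (diagHom (torusPt (ε · θ)))`
as maps of `ℝⁿ × ℝⁿ`, under the adaptedness hypothesis `δ'.im · D_j² = ε_j · t_j`, `ε_j = ±1`.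
[cite: Folland1989, Ch. 4 §1, Prop. (4.6) p. 151] -/
theorem follandScaleEquiv_conj_resAut_torusGL (hre : δ'.re = 0) {t D ε : n → ℝ} (hD0 : ∀ j, D j ≠ 0)
    (ht : ∀ j, t j ≠ 0) (hD : ∀ j, δ'.im * D j ^ 2 = ε j * t j) (hε : ∀ j, ε j = 1 ∨ ε j = -1) (θ : n → ℝ) :
    (⇑(follandScaleEquiv D t hD0 ht) ∘ ⇑(h.resAut n (torusGL θ)) ∘ ⇑(follandScaleEquiv D t hD0 ht).symm :
        PhaseMap n) = realify (diagHom (torusPt fun j => ε j * θ j)) := by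
  funext pq
  simp only [Function.comp_apply, coe_follandScaleEquiv]
  rw [follandScale_resAut_torusGL h hre ht hD hε, ← coe_follandScaleEquiv D t hD0 ht, LinearEquiv.apply_symm_apply]

/-- **The torus in the canonical adapted Folland coordinates**: with `D_j = √(|t_j| / |δ'.im|)`,
`follandScale (resAut (diag e^{iθ}) (a, b)) = realify (diagHom (torusPt (sgn(δ'.im · t_j) θ_j)_j)) (follandScale (a, b))` —
for `δ'.im > 0` the sign vector is `sgn T_jj`, the signature pattern of the real diagonal form `T`.
[cite: Folland1989, Ch. 4 §1, Prop. (4.6) p. 151] -/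
theorem follandScale_resAut_torusGL_sqrt (hre : δ'.re = 0) {t : n → ℝ} (ht : ∀ j, t j ≠ 0) (θ : n → ℝ)
    (ab : (n → ℝ) × (n → ℝ)) :
    follandScale (fun j => Real.sqrt (|t j| / |δ'.im|)) t (h.resAut n (torusGL θ) ab) =
      realify (diagHom (torusPt fun j => (SignType.sign (δ'.im * t j) : ℝ) * θ j))
        (follandScale (fun j => Real.sqrt (|t j| / |δ'.im|)) t ab) :=
  follandScale_resAut_torusGL h hre ht (fun j => adapted_sqrt (im_ne_zero_of_isQuadraticCoordinates h hre) t j)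
    (sign_eq_one_or (im_ne_zero_of_isQuadraticCoordinates h hre) ht) θ ab

end Canonical

/-! ## 5. At a complex place of a quadratic extension `E/F`: the carrier `archLocal` -/

section ArchLocal

open NumberField

variable {F : Type} (E : Type) [Field F] [NumberField F] [Field E] [NumberField E] [Algebra F E]
variable (c : E ≃ₐ[F] E) (N : ℕ) (w : {w : InfinitePlace E // InfinitePlace.IsComplex w})

/-- **`diag(e^{iθ}) ∈ U(σ_w J)(ℂ) = archLocal E N J w`** for a diagonal `F`-rational Gram matrix `J = diag(t₀) ⊗ 1` at a
complex place `w` fixed by `c ≠ 1`. [cite: MoeglinVignerasWaldspurger1987, Ch. 1 I.17] -/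
theorem torusGL_mem_archLocal (hw : c • w.1 = w.1) (hc : c ≠ 1) (t₀ : Fin N → F) {J : Matrix (Fin N) (Fin N) E}
    (hJ : J = (Matrix.diagonal t₀).map (algebraMap F E)) (θ : Fin N → ℝ) :
    torusGL θ ∈ UnitaryGroup.archLocal E N J w := by
  change torusGL θ ∈ unitaryGroupOfForm (starRingEnd ℂ) (J.map w.1.embedding)
  rw [UnitaryGroup.archLocalForm_eq_map F E c N w hw hc (Matrix.diagonal t₀) hJ, Matrix.diagonal_map (map_zero _)]
  exact torusGL_mem_unitaryGroupOfForm_map θ _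

/-- **The compact torus of `U(σ_w J)(ℂ)` through `archLocalToSymplectic`, in adapted Folland coordinates**: for
`J = diag(t₀) ⊗ 1`, `t_j = σ_w(t₀_j) ∈ ℝ` (`realPlaceMap`), `m = im σ_w(δ)` and `m · D_j² = ε_j · t_j`, `ε_j = ±1`:
`follandScale D t (archLocalToSymplectic w (diag e^{iθ}) (a, b)) = realify (diagHom (torusPt (ε · θ))) (follandScale D t (a, b))`.
[cite: Folland1989, Ch. 4 §1, Prop. (4.6) p. 151] -/
theorem follandScale_archLocalToSymplectic_torusGL (hw : c • w.1 = w.1) (hc : c ≠ 1) {δ : E} (hcδ : c δ = -δ)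
    (hδ : δ ≠ 0) (t₀ : Fin N → F) (hT : (Matrix.diagonal t₀).IsSymm) {J : Matrix (Fin N) (Fin N) E}
    (hJ : J = (Matrix.diagonal t₀).map (algebraMap F E)) (θ : Fin N → ℝ)
    (hmem : torusGL θ ∈ UnitaryGroup.archLocal E N J w) {D ε : Fin N → ℝ}
    (ht : ∀ j, UnitaryGroup.realPlaceMap F E c w hw hc (t₀ j) ≠ 0)
    (hD : ∀ j, (w.1.embedding δ).im * D j ^ 2 = ε j * UnitaryGroup.realPlaceMap F E c w hw hc (t₀ j))
    (hε : ∀ j, ε j = 1 ∨ ε j = -1) (ab : (Fin N → ℝ) × (Fin N → ℝ)) :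
    follandScale D (fun j => UnitaryGroup.realPlaceMap F E c w hw hc (t₀ j))
        ((UnitaryGroup.archLocalToSymplectic F E c N w hw hc hcδ hδ hT hJ ⟨torusGL θ, hmem⟩).1 ab) =
      realify (diagHom (torusPt fun j => ε j * θ j))
        (follandScale D (fun j => UnitaryGroup.realPlaceMap F E c w hw hc (t₀ j)) ab) :=
  follandScale_resAut_torusGL
    (isQuadraticCoordinates_complex _ (UnitaryGroup.re_embedding_delta F E c w hw hc hcδ)
      (UnitaryGroup.im_embedding_delta_ne_zero F E c w hw hc hcδ hδ))
    (UnitaryGroup.re_embedding_delta F E c w hw hc hcδ) ht hD hε θ ab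

/-- **The same with the canonical adapted scaling** `D_j = √(|t_j| / |im σ_w(δ)|)`: sign vector
`ε_j = sgn(im σ_w(δ) · σ_w(t₀_j))`. [cite: Folland1989, Ch. 4 §1, Prop. (4.6) p. 151] -/
theorem follandScale_archLocalToSymplectic_torusGL_sqrt (hw : c • w.1 = w.1) (hc : c ≠ 1) {δ : E} (hcδ : c δ = -δ)
    (hδ : δ ≠ 0) (t₀ : Fin N → F) (hT : (Matrix.diagonal t₀).IsSymm) {J : Matrix (Fin N) (Fin N) E}
    (hJ : J = (Matrix.diagonal t₀).map (algebraMap F E)) (θ : Fin N → ℝ)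
    (hmem : torusGL θ ∈ UnitaryGroup.archLocal E N J w)
    (ht : ∀ j, UnitaryGroup.realPlaceMap F E c w hw hc (t₀ j) ≠ 0) (ab : (Fin N → ℝ) × (Fin N → ℝ)) :
    follandScale (fun j => Real.sqrt (|UnitaryGroup.realPlaceMap F E c w hw hc (t₀ j)| / |(w.1.embedding δ).im|))
        (fun j => UnitaryGroup.realPlaceMap F E c w hw hc (t₀ j))
        ((UnitaryGroup.archLocalToSymplectic F E c N w hw hc hcδ hδ hT hJ ⟨torusGL θ, hmem⟩).1 ab) =
      realify (diagHom (torusPt fun j =>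
          (SignType.sign ((w.1.embedding δ).im * UnitaryGroup.realPlaceMap F E c w hw hc (t₀ j)) : ℝ) * θ j))
        (follandScale (fun j => Real.sqrt (|UnitaryGroup.realPlaceMap F E c w hw hc (t₀ j)| / |(w.1.embedding δ).im|))
          (fun j => UnitaryGroup.realPlaceMap F E c w hw hc (t₀ j)) ab) :=
  follandScale_resAut_torusGL_sqrt
    (isQuadraticCoordinates_complex _ (UnitaryGroup.re_embedding_delta F E c w hw hc hcδ)
      (UnitaryGroup.im_embedding_delta_ne_zero F E c w hw hc hcδ hδ))
    (UnitaryGroup.re_embedding_delta F E c w hw hc hcδ) ht θ ab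

end ArchLocal

end Literature.NumberTheory.Weil1964
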